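import Summits.QuantumAdvantage.QuantumAdvantage.Theorems.SparsityDialMP12

/-!
# SparsityDial — part MP13 of 13 of the «MovingPointers» package (decomp-qadv lens 2, g18): §I JUNTA-INDEXED TABLES — `JuntaTableLossG3` / `JuntaTableLossSG3` (PROVED)

Imports its predecessor `SparsityDialMP12` (linear chain MP1 → … → MP13); the package overview is the module docstring of `SparsityDialMP1`.
This part: a deviation table that is ANY function of the input bits on a set `J` of `≤ (log₂ n)^c` positions (values of size
`≤ (log₂ n)^c`) is realised exactly as an affine table on the coordinate hash of `J` (`junta_table_as_affine`), so the gauged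
affine-table rung of part MP11 gives `JuntaTableLossG3` and, in piece S's own shape, `JuntaTableLossSG3` (below `SparseGenericLoss3` by
name: `juntaSG_of_sparse`); `juntaHashTable_loss`: tables indexed by hashes that are arbitrary functions (any degree) of `x|_J`.
No `sorry`; standard axioms; no instances / notation.
-/

set_option linter.unusedVariables false
set_option linter.dupNamespace false

noncomputable section
open scoped Classical

namespace Summit.QuantumAdvantage.QuantumAdvantage.Theorems.SparsityDial

open Finset
open Literature.Computability.QuantumComplexity Literature.Computability.QuantumComplexity.RingHLF
open Literature.Computability.MetaComplexity Literature.Computability.MetaComplexity.Smolensky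
open Summit.QuantumAdvantage.AdviceFreeQNC0
open Summit.QuantumAdvantage.QuantumAdvantage.Theorems.HolonomyDial (gCond)
open Summit.QuantumAdvantage.QuantumAdvantage.Theorems.LocusDial
open Summit.QuantumAdvantage.QuantumAdvantage.Theorems.AnchorDial (dev outB win_iff card_odd_ge)
open Summit.QuantumAdvantage.QuantumAdvantage.Theorems.HolonomyDial (card_odd_le)
open Summit.QuantumAdvantage.QuantumAdvantage.Theorems.StabilizerDial (eventually_polylog StabFew stabFew_of_fewLocus)

/-! ## §I  JUNTA-INDEXED TABLES ARE AFFINE TABLES: deviation sets that are ANY function of a polylog-size set of input bits -/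

section Junta
variable {N : ℕ}

open Summit.QuantumAdvantage.QuantumAdvantage.Theorems.StabilizerDial (pad winset_pad)

/-- the coordinate row: `M r i = [i = e r]`, so that the `r`-th hash trit is the input bit `x (e r)` read as `0/1 ∈ 𝔽₃`. -/
theorem linHash_coord {t : ℕ} (e : Fin t → Fin N) (x : Fin N → Bool) (r : Fin t) :
    linHash (fun r i => if i = e r then (1 : ZMod 3) else 0) x r = if x (e r) then 1 else 0 := by
  simp only [linHash]
  rw [Finset.sum_eq_single (e r) (fun i _ hi => by simp [hi]) (fun h => absurd (Finset.mem_univ _) h)]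
  simp

/-- **junta tables are affine tables**: a table `S x` depending only on the bits `x|_J` is realised EXACTLY as an affine table
`S' (linHash M x)` on the coordinate hash of `J` (`t = |J|` trits), with the same values. -/
theorem junta_table_as_affine (J : Finset (Fin N)) (S : (Fin N → Bool) → Finset (Fin N))
    (hJ : ∀ x y : Fin N → Bool, (∀ i ∈ J, x i = y i) → S x = S y) :
    ∃ (M : Fin J.card → Fin N → ZMod 3) (S' : (Fin J.card → ZMod 3) → Finset (Fin N)),
      (∀ v, ∃ y, S' v = S y) ∧ ∀ x, S' (linHash M x) = S x := by
  classical
  let e : Fin J.card ≃ {i // i ∈ J} := J.equivFin.symm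
  refine ⟨fun r i => if i = (e r : Fin N) then 1 else 0,
    fun v => S (fun i => if h : i ∈ J then decide (v (e.symm ⟨i, h⟩) = 1) else false), fun v => ⟨_, rfl⟩, fun x => ?_⟩
  apply hJ
  intro i hi
  rw [dif_pos hi, linHash_coord]
  have hei : ((e (e.symm ⟨i, hi⟩)) : Fin N) = i := by simp
  rw [hei]
  cases x i <;> decide

/-- **`JuntaTableLossG3`** — the rung in GAUGED form: eventually, for every set `J` of at most `(log₂ n)^c` input positions and
every table `S` that is an ARBITRARY function of the bits `x|_J` with values of size `≤ (log₂ n)^c`, every strategy some gauge of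
which has deviation set `S x` on every odd input wins at most `(1 − n^{−C})·2^{n−1}` of the odd class.  This contains every table
indexed by a hash `h = (h_1,…,h_t)` whose trits are arbitrary functions of `x|_J` — in particular every SPARSE low-degree hash
(polylog many monomials of polylog degree: `J` = the union of the monomial supports). -/
def JuntaTableLossG3 : Prop := ∃ C : ℕ, ∀ c : ℕ, ∃ n₀ : ℕ, ∀ n ≥ n₀, ∀ J : Finset (Fin n), J.card ≤ (Nat.log 2 n) ^ c →
  ∀ S : (Fin n → Bool) → Finset (Fin n), (∀ x y : Fin n → Bool, (∀ i ∈ J, x i = y i) → S x = S y) →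
    (∀ x, (S x).card ≤ (Nat.log 2 n) ^ c) →
    ∀ P : Fin n → CubeFn (ZMod 3) n,
      (∃ s : Fin n → CubeFn (ZMod 3) n, ∀ x, OddZeros x → dev (pad P s) x = S x) →
      ((univ.filter fun x : Fin n → Bool => OddZeros x ∧ Rel x (fun i => decide (P i x = 1))).card : ℝ) ≤
        (1 - 1 / (n : ℝ) ^ C) * (2 : ℝ) ^ (n - 1)

/-- junta tables from gauged affine tables. -/
theorem juntaG_of_tableG (h : AffineTableLossG3) : JuntaTableLossG3 := by
  obtain ⟨C, hC⟩ := h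
  refine ⟨C, fun c => ?_⟩
  obtain ⟨n₀, hn₀⟩ := hC c
  refine ⟨n₀, fun n hn J hJc S hJ hcard P hs => ?_⟩
  obtain ⟨M, S', hS', hkey⟩ := junta_table_as_affine J S hJ
  obtain ⟨s, hdev⟩ := hs
  refine hn₀ n hn J.card hJc M S' (fun v => ?_) P ⟨s, fun x hx => by rw [hkey]; exact hdev x hx⟩
  obtain ⟨y, hy⟩ := hS' v
  rw [hy]; exact hcard y

/-- **PROVED.** -/
theorem juntaTableLossG3 : JuntaTableLossG3 := juntaG_of_tableG affineTableLossG3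

/-- **`JuntaTableLossSG3`** — the same in piece S's own shape (`∀ c, ∃ C`; `P` of degree `≤ (log₂ n)^c` and essentially
nonlocal; admissible gauge of degree `≤ (log₂ n)^{c+1}`): LITERALLY below S (`juntaSG_of_sparse`) and PROVED. -/
def JuntaTableLossSG3 : Prop := ∀ c : ℕ, ∃ C : ℕ, ∃ n₀ : ℕ, ∀ n ≥ n₀, ∀ J : Finset (Fin n), J.card ≤ (Nat.log 2 n) ^ c →
  ∀ S : (Fin n → Bool) → Finset (Fin n), (∀ x y : Fin n → Bool, (∀ i ∈ J, x i = y i) → S x = S y) →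
    (∀ x, (S x).card ≤ (Nat.log 2 n) ^ c) →
    ∀ P : Fin n → CubeFn (ZMod 3) n, (∀ i, P i ∈ lowDeg (ZMod 3) n ((Nat.log 2 n) ^ c)) →
      ¬ StabFew 1 0 (c + 1) P →
      (∃ s : Fin n → CubeFn (ZMod 3) n, (∀ i, s i ∈ lowDeg (ZMod 3) n ((Nat.log 2 n) ^ (c + 1))) ∧
        ∀ x, OddZeros x → dev (pad P s) x = S x) →
      ((univ.filter fun x : Fin n → Bool => OddZeros x ∧ Rel x (fun i => decide (P i x = 1))).card : ℝ) ≤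
        (1 - 1 / (n : ℝ) ^ C) * (2 : ℝ) ^ (n - 1)

/-- junta S-form from the affine-table S-form. -/
theorem juntaSG_of_tableSG (h : AffineTableLossSG3) : JuntaTableLossSG3 := by
  intro c
  obtain ⟨C, n₀, hn₀⟩ := h c
  refine ⟨C, n₀, fun n hn J hJc S hJ hcard P hP hgen hs => ?_⟩
  obtain ⟨M, S', hS', hkey⟩ := junta_table_as_affine J S hJ
  obtain ⟨s, hsdeg, hdev⟩ := hs
  refine hn₀ n hn J.card hJc M S' (fun v => ?_) P hP hgen ⟨s, hsdeg, fun x hx => by rw [hkey]; exact hdev x hx⟩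
  obtain ⟨y, hy⟩ := hS' v
  rw [hy]; exact hcard y

/-- **below S by name**: `SparseGenericLoss3 → JuntaTableLossSG3`. -/
theorem juntaSG_of_sparse (hS : SparseGenericLoss3) : JuntaTableLossSG3 := juntaSG_of_tableSG (tableSG_of_sparse hS)

/-- **PROVED.** -/
theorem juntaTableLossSG3 : JuntaTableLossSG3 := juntaSG_of_tableSG affineTableLossSG3

/-- **junta-HASH tables** (the form nearest to the typed residual `PolyTableLoss3`): if the hash trits `h_r` are arbitrary
functions of the bits `x|_J`, `|J| ≤ (log₂ n)^c` — e.g. ANY polynomials (of any degree) in the variables of `J` — then the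
table strategy `dev (pad P s) x = S (h x)` loses.  What is left of `PolyTableLoss3` after this: low-degree hashes that depend on
MORE than polylogarithmically many variables (high-arity, e.g. high-rank quadratic forms). -/
theorem juntaHashTable_loss : ∃ C : ℕ, ∀ c : ℕ, ∃ n₀ : ℕ, ∀ n ≥ n₀, ∀ J : Finset (Fin n), J.card ≤ (Nat.log 2 n) ^ c →
    ∀ (t : ℕ) (h : Fin t → CubeFn (ZMod 3) n) (S : (Fin t → ZMod 3) → Finset (Fin n)),
      (∀ r, ∀ x y : Fin n → Bool, (∀ i ∈ J, x i = y i) → h r x = h r y) → (∀ v, (S v).card ≤ (Nat.log 2 n) ^ c) →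
      ∀ P : Fin n → CubeFn (ZMod 3) n,
        (∃ s : Fin n → CubeFn (ZMod 3) n, ∀ x, OddZeros x → dev (pad P s) x = S (fun r => h r x)) →
        ((univ.filter fun x : Fin n → Bool => OddZeros x ∧ Rel x (fun i => decide (P i x = 1))).card : ℝ) ≤
          (1 - 1 / (n : ℝ) ^ C) * (2 : ℝ) ^ (n - 1) := by
  obtain ⟨C, hC⟩ := juntaTableLossG3
  refine ⟨C, fun c => ?_⟩
  obtain ⟨n₀, hn₀⟩ := hC c
  refine ⟨n₀, fun n hn J hJc t h S hh hcard P hs => ?_⟩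
  refine hn₀ n hn J hJc (fun x => S (fun r => h r x)) (fun x y hxy => ?_) (fun x => hcard _) P hs
  have : (fun r => h r x) = fun r => h r y := funext fun r => hh r x y hxy
  rw [this]

end Junta

/-- info: 'Summit.QuantumAdvantage.QuantumAdvantage.Theorems.SparsityDial.juntaTableLossG3' depends on axioms: [propext,
 Classical.choice,
 Quot.sound] -/
#guard_msgs in #print axioms juntaTableLossG3

/-- info: 'Summit.QuantumAdvantage.QuantumAdvantage.Theorems.SparsityDial.juntaTableLossSG3' depends on axioms: [propext,
 Classical.choice,
 Quot.sound] -/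
#guard_msgs in #print axioms juntaTableLossSG3

/-- info: 'Summit.QuantumAdvantage.QuantumAdvantage.Theorems.SparsityDial.juntaSG_of_sparse' depends on axioms: [propext,
 Classical.choice,
 Quot.sound] -/
#guard_msgs in #print axioms juntaSG_of_sparse

/-- info: 'Summit.QuantumAdvantage.QuantumAdvantage.Theorems.SparsityDial.juntaHashTable_loss' depends on axioms: [propext,
 Classical.choice,
 Quot.sound] -/
#guard_msgs in #print axioms juntaHashTable_loss



end Summit.QuantumAdvantage.QuantumAdvantage.Theorems.SparsityDial
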